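import Literature.Analysis.FluidPDE.ChaeWolfRemovingDSS
import Literature.Analysis.FluidPDE.KNSSMildDecayProofs
import Literature.Analysis.FluidPDE.KNSSThm53OfWindow
import Literature.Analysis.FluidPDE.ClassicalBoundedWeak
import HarnessLib

/-!
# Chae–Wolf 2017, Theorem 1.3 — a priori inputs: smallness and uniform Lipschitz bounds

Analysis/FluidPDE proofs file (everything proved; no definitions, no named facts), first of three
files discharging the named fact `Literature.Analysis.FluidPDE.chaeWolf2017_removing_dss`
(`ChaeWolfRemovingDSS.lean`; D. Chae, J. Wolf, *Removing discretely self-similar singularities for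
the 3D Navier–Stokes equations*, Comm. PDE 42 (2017) 1359–1374 = arXiv:1610.09464, **Theorem 1.3**,
proof in §3, pp. 8–9 of the arXiv text). The discharge `chaeWolf2017_removing_dss_holds` is in
`ChaeWolfRemovingDSSProofs.lean`; the extraction of the self-similar limit is in
`ChaeWolfRemovingDSSLimit.lean`. This file provides the two analytic inputs of the indirect
argument of §3 for classical solutions `(u, p)` on `ℝ³ × (−∞, 0)` with a Type I bound
`‖u(t, x)‖ ≤ C₀/(‖x‖ + √(−t))` (`HasTypeIDecay C₀ u`):

* `ChaeWolf.exists_eps_typeI_small_eq_zero` — **Step 1 in substitute form**: there is an absolute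
  `ε₀ > 0` such that `√(−t)‖u(t, x)‖ ≤ ε₀` throughout forces `u ≡ 0`. The printed Step 1 obtains
  the lower bound `∫_{Q(0,1)}|u|³ > ε³` for nontrivial DSS solutions from Wolf's `ε`-regularity
  criterion for local suitable weak solutions (not in the tree); we use instead that Type I
  classical solutions are *mild* — KNSS 2009, Thm. 6.1, mildness clause,
  `KNSS2009_mild_of_rMulNorm_bounded_holds` (the Type I bound gives `|x'|‖u‖ ≤ C₀`) — and the
  Koch–Tataru bound `‖K(τ, z)‖ ≤ C(τ + |z|²)^{-2}` of the Oseen kernel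
  (`exists_norm_oseenKernel_le`): the scale-invariant supremum `B = sup √(−t)‖u‖` satisfies
  `B ≤ B/2 + K₀B²` (Duhamel from time `4t` to `t`), hence vanishes when `K₀ B ≤ 1/4`. The role of
  the lemma in the proof is the same as that of the printed Step 1: nontrivial solutions have a
  scale-invariant quantity bounded below by an absolute constant (`ChaeWolf.exists_witness`,
  next file).
* `ChaeWolf.exists_uniform_lipschitz` — **the a priori estimates (3.6)–(3.7)** in the form needed
  for the Arzelà–Ascoli extraction: constants `K, L` depending only on `C₀` such that every such
  solution is `K`-Lipschitz in `x` and `L`-Lipschitz in `t` on `(−∞, −1/4] × ℝ³`. Printed: "by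
  using the regularity theory of the Navier–Stokes equations we infer
  `|∇ˡu| ≤ C_l/((−t)^{(1+l)/2} + |x|^{1+l})`"; here the regularity theory is KNSS 2009 §4 for
  bounded weak solutions (`KNSS2009_regularity_boundedWeak_window_holds`, applied on the windows
  `(t − 2, t + 1/8)`, `t ≤ −1/4`, where `|u| ≤ 3C₀`, to the pressure-free weak form of the
  classical solution, `IsClassicalNSSolutionOn.isBoundedWeakNSSolutionOn`), whose drift `b(t)` is
  tamed by the spatial decay of `u` (`ChaeWolf.window_transfer`: `U(t, y) → −b(t)` as
  `|y| → ∞`, so `b` inherits the Lipschitz bound of `U`; continuity in `t` removes the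
  exceptional times).

## References

* D. Chae, J. Wolf, Comm. PDE 42 (2017) 1359–1374 = arXiv:1610.09464, §3, proof of Thm. 1.3,
  Step 1 and (3.4)–(3.7) (arXiv p. 8). [ChaeWolf2017RemovingDSS]
* G. Koch, N. Nadirashvili, G. Seregin, V. Šverák, Acta Math. 203 (2009) = arXiv:0709.3599, §4
  and Thm. 6.1. [KochNadirashviliSereginSverak2009]
* H. Koch, D. Tataru, Adv. Math. 157 (2001), (14). [KochTataruAdvMath2001]
-/

noncomputable section

open MeasureTheory Set Function Filter Metric Real intervalIntegral
open _root_.Topology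
open scoped ENNReal NNReal ContDiff Laplacian

namespace Literature.Analysis.FluidPDE

namespace ChaeWolf


/-! ### The time weight `∫_{4t}^{t} (t - σ)^{-1/2} dσ = 2 √(-3t)` -/

/-- For `t < 0` the weight `σ ↦ (t - σ)^{-1/2}` is integrable on `(4t, t)`. [folklore] -/
theorem integrableOn_rpow_sub {t : ℝ} (ht : t < 0) :
    IntegrableOn (fun σ : ℝ => (t - σ) ^ (-(1 / 2 : ℝ))) (Ioo (4 * t) t) := by
  have h4 : 4 * t ≤ t := by linarith
  have hII : IntervalIntegrable (fun x : ℝ => x ^ (-(1 / 2 : ℝ))) volume (-(3 * t)) 0 :=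
    intervalIntegral.intervalIntegrable_rpow' (by norm_num)
  have hc := hII.comp_sub_left t
  have e1 : t - -(3 * t) = 4 * t := by ring
  have e2 : t - 0 = t := by ring
  rw [e1, e2] at hc
  exact (intervalIntegrable_iff_integrableOn_Ioo_of_le h4).1 hc

/-- `∫_{(4t, t)} (t - σ)^{-1/2} dσ = 2 √(-3t)` for `t < 0`. [folklore] -/
theorem integral_rpow_sub {t : ℝ} (ht : t < 0) :
    ∫ σ in Ioo (4 * t) t, (t - σ) ^ (-(1 / 2 : ℝ)) = 2 * √(-(3 * t)) := by
  have h4 : 4 * t ≤ t := by linarith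
  rw [← integral_Ioc_eq_integral_Ioo, ← intervalIntegral.integral_of_le h4,
    intervalIntegral.integral_comp_sub_left (fun x : ℝ => x ^ (-(1 / 2 : ℝ))) t]
  have e1 : t - t = 0 := by ring
  have e2 : t - 4 * t = -(3 * t) := by ring
  rw [e1, e2, integral_rpow (Or.inl (by norm_num))]
  have e3 : (-(1 / 2 : ℝ)) + 1 = 1 / 2 := by norm_num
  rw [e3, Real.zero_rpow (by norm_num), sub_zero, Real.sqrt_eq_rpow]
  ring

/-! ### The spatial integral of the Oseen kernel against Type I data -/

variable {C : ℝ}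

/-- **Inner (spatial) bound.** If the Oseen kernel obeys
`‖K(τ, z)[a, b]‖ ≤ C (τ + ‖z‖²)^{-2} ‖a‖ ‖b‖` (Koch–Tataru's (14) in dimension three) and
`‖f‖ ≤ A`, then
`‖∫ K(τ, x - y)[f y, f y] dy‖ ≤ C M₀ τ^{-1/2} A²`, `M₀ = ∫ (1 + ‖w‖²)^{-2} dw`. [folklore] -/
theorem norm_integral_oseenKernel_le
    (hK : ∀ {τ : ℝ}, 0 < τ → ∀ z a b : (EuclideanSpace ℝ (Fin 3)),
      ‖oseenKernel τ z a b‖ ≤ C * (τ + ‖z‖ ^ 2) ^ (-(2 : ℝ)) * ‖a‖ * ‖b‖)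
    (hC : 0 ≤ C) {τ : ℝ} (hτ : 0 < τ) (x : EuclideanSpace ℝ (Fin 3))
    {f : EuclideanSpace ℝ (Fin 3) → EuclideanSpace ℝ (Fin 3)} {A : ℝ} (hA : ∀ y, ‖f y‖ ≤ A) :
    ‖∫ y, oseenKernel τ (x - y) (f y) (f y)‖ ≤
      C * (∫ w : EuclideanSpace ℝ (Fin 3), (1 + ‖w‖ ^ 2) ^ (-(2 : ℝ))) *
        τ ^ (-(1 / 2 : ℝ)) * A ^ 2 := by
  have hA0 : 0 ≤ A := (norm_nonneg _).trans (hA 0)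
  have finrank_R3_real : ((Module.finrank ℝ (EuclideanSpace ℝ (Fin 3)) : ℕ) : ℝ) = 3 := by
    simp
  have he : ((Module.finrank ℝ (EuclideanSpace ℝ (Fin 3)) : ℕ) : ℝ) < 2 * 2 := by
    rw [finrank_R3_real]; norm_num
  have hw : Integrable (fun z : EuclideanSpace ℝ (Fin 3) => (τ + ‖z‖ ^ 2) ^ (-(2 : ℝ))) :=
    integrable_add_norm_sq_rpow_neg he hτ
  have hwx : Integrable (fun y : EuclideanSpace ℝ (Fin 3) => (τ + ‖x - y‖ ^ 2) ^ (-(2 : ℝ))) :=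
    hw.comp_sub_left x
  have hbound : ∀ y, ‖oseenKernel τ (x - y) (f y) (f y)‖ ≤
      C * A ^ 2 * (τ + ‖x - y‖ ^ 2) ^ (-(2 : ℝ)) := by
    intro y
    have h1 := hK hτ (x - y) (f y) (f y)
    have hwnn : 0 ≤ (τ + ‖x - y‖ ^ 2) ^ (-(2 : ℝ)) := Real.rpow_nonneg (by positivity) _
    calc ‖oseenKernel τ (x - y) (f y) (f y)‖
        ≤ C * (τ + ‖x - y‖ ^ 2) ^ (-(2 : ℝ)) * ‖f y‖ * ‖f y‖ := h1
      _ ≤ C * (τ + ‖x - y‖ ^ 2) ^ (-(2 : ℝ)) * A * A := by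
          gcongr
          · exact hA y
          · exact hA y
      _ = C * A ^ 2 * (τ + ‖x - y‖ ^ 2) ^ (-(2 : ℝ)) := by ring
  refine (norm_integral_le_of_norm_le (hwx.const_mul (C * A ^ 2))
    (Eventually.of_forall hbound)).trans ?_
  rw [MeasureTheory.integral_const_mul]
  have hsub : ∫ y : EuclideanSpace ℝ (Fin 3), (τ + ‖x - y‖ ^ 2) ^ (-(2 : ℝ)) =
      ∫ z : EuclideanSpace ℝ (Fin 3), (τ + ‖z‖ ^ 2) ^ (-(2 : ℝ)) :=
    integral_sub_left_eq_self (fun z : EuclideanSpace ℝ (Fin 3) => (τ + ‖z‖ ^ 2) ^ (-(2 : ℝ)))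
      volume x
  rw [hsub, integral_add_norm_sq_rpow_neg hτ 2, finrank_R3_real]
  have e : (3 : ℝ) / 2 - 2 = -(1 / 2 : ℝ) := by norm_num
  rw [e]
  ring_nf
  rfl

/-! ### Small Type I ancient solutions vanish -/

/-- `√(-(4t)) = 2 √(-t)`. [folklore] -/
theorem sqrt_neg_four_mul (t : ℝ) : √(-(4 * t)) = 2 * √(-t) := by
  rw [show -(4 * t) = 2 ^ 2 * -t by ring, Real.sqrt_mul (by norm_num), Real.sqrt_sq (by norm_num)]

/-- `√(-(3t)) ≤ 2 √(-t)`. [folklore] -/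
theorem sqrt_neg_three_mul_le (t : ℝ) (ht : t < 0) : √(-(3 * t)) ≤ 2 * √(-t) := by
  rw [← sqrt_neg_four_mul]
  exact Real.sqrt_le_sqrt (by linarith)

/-- **Chae–Wolf 2017, proof of Thm. 1.3, Step 1 (substitute): Type I ancient solutions with a small
scale-invariant bound vanish.** There is an absolute `ε₀ > 0` such that every classical solution
`(u, p)` of Navier–Stokes (`ν = 1`, `f = 0`) on `ℝ³ × (−∞, 0)` with a Type I bound
`‖u(t, x)‖ ≤ C₀/(‖x‖ + √(−t))` (any `C₀ ≥ 0`) and `√(−t) ‖u(t, x)‖ ≤ ε₀` throughout vanishes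
identically. (The printed Step 1 uses Wolf's `ε`-regularity criterion instead; here the mildness of
Type I classical solutions, KNSS 2009 Thm. 6.1 (`KNSS2009_mild_of_rMulNorm_bounded_holds`), and the
Oseen kernel bound `‖K(τ, z)‖ ≤ C (τ + |z|²)^{-2}` give `B ≤ B/2 + K₀ B²` for
`B = sup √(−t)‖u‖`, whence `B = 0` once `K₀ B ≤ 1/4`.) [cite: ChaeWolf2017RemovingDSS, §3 Step 1 (arXiv:1610.09464 p. 8)] -/
theorem exists_eps_typeI_small_eq_zero :
    ∃ ε₀ : ℝ, 0 < ε₀ ∧ ∀ {C₀ : ℝ} {u : ℝ → EuclideanSpace ℝ (Fin 3) → EuclideanSpace ℝ (Fin 3)}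
      {p : ℝ → EuclideanSpace ℝ (Fin 3) → ℝ},
      0 ≤ C₀ → IsClassicalNSSolutionOn (Iio 0) 1 0 u p → HasTypeIDecay C₀ u →
      (∀ t < 0, ∀ x, √(-t) * ‖u t x‖ ≤ ε₀) → ∀ t < 0, ∀ x, u t x = 0 := by
  obtain ⟨C, hC, hK⟩ := exists_norm_oseenKernel_le (E := (EuclideanSpace ℝ (Fin 3)))
  set M₀ : ℝ := ∫ w : EuclideanSpace ℝ (Fin 3), (1 + ‖w‖ ^ 2) ^ (-(2 : ℝ)) with hM₀
  have hM₀0 : 0 ≤ M₀ := integral_nonneg fun w => Real.rpow_nonneg (by positivity) _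
  set K₀ : ℝ := 4 * C * M₀ with hK₀
  have hK₀0 : 0 ≤ K₀ := by positivity
  set ε : ℝ := 1 / (4 * K₀ + 4) with hε
  have hε0 : 0 < ε := by positivity
  have hKε : K₀ * ε ≤ 1 / 4 := by
    rw [hε, mul_one_div, div_le_iff₀ (by positivity)]
    linarith
  refine ⟨ε, hε0, ?_⟩
  intro C₀ u p hC₀ hcl hI hsmall
  -- the kernel bound in dimension three
  have finrank_R3_real : ((Module.finrank ℝ (EuclideanSpace ℝ (Fin 3)) : ℕ) : ℝ) = 3 := by
    simp
  have hK' : ∀ {τ : ℝ}, 0 < τ → ∀ z a b : (EuclideanSpace ℝ (Fin 3)),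
      ‖oseenKernel τ z a b‖ ≤ C * (τ + ‖z‖ ^ 2) ^ (-(2 : ℝ)) * ‖a‖ * ‖b‖ := by
    intro τ hτ z a b
    have h := hK hτ z a b
    rw [finrank_R3_real, show (-(((3 : ℝ) + 1) / 2)) = -(2 : ℝ) by norm_num] at h
    exact h
  -- the scale-invariant supremum `B`
  set S : Set ℝ := {r | ∃ t : ℝ, t < 0 ∧ ∃ x : EuclideanSpace ℝ (Fin 3), r = √(-t) * ‖u t x‖}
    with hS
  have hSb : BddAbove S := ⟨ε, by rintro r ⟨t, ht, x, rfl⟩; exact hsmall t ht x⟩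
  have hSn : S.Nonempty := ⟨_, -1, by norm_num, 0, rfl⟩
  set B : ℝ := sSup S with hB
  have hqB : ∀ t < 0, ∀ x, √(-t) * ‖u t x‖ ≤ B := fun t ht x =>
    le_csSup hSb ⟨t, ht, x, rfl⟩
  have hBε : B ≤ ε := csSup_le hSn (by rintro r ⟨t, ht, x, rfl⟩; exact hsmall t ht x)
  have hB0 : 0 ≤ B := le_trans (by positivity) (hqB (-1) (by norm_num) 0)
  have hptw : ∀ σ < 0, ∀ y, ‖u σ y‖ ≤ B / √(-σ) := by
    intro σ hσ y
    have hs : 0 < √(-σ) := Real.sqrt_pos.2 (by linarith)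
    rw [le_div_iff₀ hs, mul_comm]
    exact hqB σ hσ y
  -- the key estimate `√(-t) ‖u(t, x)‖ ≤ B/2 + K₀ B²`
  have hkey : ∀ t < 0, ∀ x, √(-t) * ‖u t x‖ ≤ B / 2 + K₀ * B ^ 2 := by
    intro t ht x
    set r : ℝ := √(-t) with hr
    have hr0 : 0 < r := Real.sqrt_pos.2 (by linarith)
    have hr2 : r ^ 2 = -t := Real.sq_sqrt (by linarith)
    -- the mild identity between `4t` and `t`
    have hcl' : IsClassicalNSSolutionOn (Ioo (4 * t - 1) 0) 1 0 u p :=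
      hcl.mono Ioo_subset_Iio_self (uniqueDiffOn_Ioo _ _)
    have hL : ∃ L : ℝ, ∀ t' ∈ Ioc (4 * t - 1) t, ∀ y, ‖u t' y‖ ≤ L := by
      refine ⟨B / r, fun t' ht' y => (hptw t' (by linarith [ht'.2]) y).trans ?_⟩
      exact div_le_div_of_nonneg_left hB0 hr0 (Real.sqrt_le_sqrt (by linarith [ht'.2]))
    have hD : ∃ D : ℝ, ∀ t' ∈ Ioc (4 * t - 1) t, ∀ y, cylRadius y * ‖u t' y‖ ≤ D := by
      refine ⟨C₀, fun t' ht' y => ?_⟩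
      have ht'0 : t' < 0 := by linarith [ht'.2]
      have hs : 0 < √(-t') := Real.sqrt_pos.2 (by linarith)
      have hden : 0 < ‖y‖ + √(-t') := by positivity
      have hcyl : cylRadius y ≤ ‖y‖ := by
        rw [cylRadius, EuclideanSpace.norm_eq]
        apply Real.sqrt_le_sqrt
        simp only [Fin.sum_univ_three, Real.norm_eq_abs, sq_abs]
        nlinarith [sq_nonneg (y 2)]
      calc cylRadius y * ‖u t' y‖ ≤ ‖y‖ * (C₀ / (‖y‖ + √(-t'))) := by
            gcongr
            · exact hI t' ht'0 y
        _ = C₀ * (‖y‖ / (‖y‖ + √(-t'))) := by ring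
        _ ≤ C₀ * 1 := by
            gcongr
            rw [div_le_one hden]
            linarith [hs.le]
        _ = C₀ := mul_one _
    have hmild := KNSS2009_mild_of_rMulNorm_bounded_holds hcl' (by linarith) ht hL hD
      (s := 4 * t) (t := t) (by linarith) (by linarith) le_rfl x
    -- the caloric term
    have hheat :
        ‖UnboundedOperators.heatExtension (u (4 * t)) (t - 4 * t) x‖ ≤ B / (2 * r) := by
      have hb : ∀ z, ‖u (4 * t) z‖ ≤ B / (2 * r) := by
        intro z
        have := hptw (4 * t) (by linarith) z
        rwa [sqrt_neg_four_mul, ← hr] at this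
      exact UnboundedOperators.norm_heatExtension_le_of_bound hb (by linarith) x
    -- the Duhamel term
    have hduh : ‖oseenDuhamel 1 (4 * t) u u t x‖ ≤ K₀ * B ^ 2 / r := by
      rw [oseenDuhamel_apply]
      have hG : IntegrableOn (fun σ : ℝ => C * M₀ * (B ^ 2 / r ^ 2) * (t - σ) ^ (-(1 / 2 : ℝ)))
          (Ioo (4 * t) t) := (integrableOn_rpow_sub ht).const_mul _
      have hpt : ∀ᵐ σ ∂(volume.restrict (Ioo (4 * t) t)),
          ‖∫ y, oseenKernel (1 * (t - σ)) (x - y) (u σ y) (u σ y)‖ ≤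
            C * M₀ * (B ^ 2 / r ^ 2) * (t - σ) ^ (-(1 / 2 : ℝ)) := by
        refine ae_restrict_of_forall_mem measurableSet_Ioo fun σ hσ => ?_
        have hσ0 : σ < 0 := hσ.2.trans ht
        have hτ : 0 < 1 * (t - σ) := by linarith [hσ.2]
        have h1 := norm_integral_oseenKernel_le hK' hC.le hτ x (hptw σ hσ0)
        rw [one_mul] at h1 ⊢
        refine h1.trans ?_
        have hsq : (B / √(-σ)) ^ 2 = B ^ 2 / (-σ) := by
          rw [div_pow, Real.sq_sqrt (by linarith)]
        rw [hsq]
        have hw0 : 0 ≤ (t - σ) ^ (-(1 / 2 : ℝ)) := Real.rpow_nonneg (by linarith [hσ.2]) _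
        have hfrac : B ^ 2 / (-σ) ≤ B ^ 2 / r ^ 2 := by
          rw [hr2]
          exact div_le_div_of_nonneg_left (sq_nonneg B) (by linarith) (by linarith [hσ.2])
        calc C * M₀ * (t - σ) ^ (-(1 / 2 : ℝ)) * (B ^ 2 / -σ)
            ≤ C * M₀ * (t - σ) ^ (-(1 / 2 : ℝ)) * (B ^ 2 / r ^ 2) := by gcongr
          _ = C * M₀ * (B ^ 2 / r ^ 2) * (t - σ) ^ (-(1 / 2 : ℝ)) := by ring
      refine (norm_integral_le_of_norm_le hG hpt).trans ?_
      rw [MeasureTheory.integral_const_mul, integral_rpow_sub ht]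
      have h3 := sqrt_neg_three_mul_le t ht
      rw [← hr] at h3
      have hrr : r ^ 2 = r * r := sq r
      calc C * M₀ * (B ^ 2 / r ^ 2) * (2 * √(-(3 * t)))
          ≤ C * M₀ * (B ^ 2 / r ^ 2) * (2 * (2 * r)) := by gcongr
        _ = K₀ * B ^ 2 / r := by
            rw [hK₀, hrr]
            field_simp
            ring
    -- assemble
    have hnorm : ‖u t x‖ ≤ B / (2 * r) + K₀ * B ^ 2 / r := by
      rw [hmild]
      exact (norm_sub_le _ _).trans (add_le_add hheat hduh)
    calc r * ‖u t x‖ ≤ r * (B / (2 * r) + K₀ * B ^ 2 / r) := by gcongr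
      _ = B / 2 + K₀ * B ^ 2 := by field_simp
  -- bootstrap: `B ≤ B/2 + K₀ B²` and `B ≤ ε` force `B = 0`
  have hB1 : B ≤ B / 2 + K₀ * B ^ 2 :=
    csSup_le hSn (by rintro r ⟨t, ht, x, rfl⟩; exact hkey t ht x)
  have hB2 : K₀ * B ^ 2 ≤ B / 4 := by
    calc K₀ * B ^ 2 = (K₀ * B) * B := by ring
      _ ≤ (K₀ * ε) * B := by gcongr
      _ ≤ (1 / 4) * B := by gcongr
      _ = B / 4 := by ring
  have hB00 : B ≤ 0 := by linarith
  intro t ht x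
  have hst : 0 < √(-t) := Real.sqrt_pos.2 (by linarith)
  have h := hqB t ht x
  have h' : √(-t) * ‖u t x‖ ≤ 0 := h.trans hB00
  have hn : ‖u t x‖ ≤ 0 := by
    by_contra hcon
    push Not at hcon
    have : 0 < √(-t) * ‖u t x‖ := mul_pos hst hcon
    linarith
  exact norm_le_zero_iff.1 hn



/-! ### From almost every time to every time, for continuous quantities -/

/-- A function continuous on an open interval which is `≤ K` at almost every time of the interval
is `≤ K` at every time of the interval (a strict inequality would persist on a ball of positive
measure). [folklore] -/
theorem le_of_ae_le_of_continuousOn {g : ℝ → ℝ} {a b K : ℝ} (hg : ContinuousOn g (Ioo a b))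
    (h : ∀ᵐ τ ∂((volume : Measure ℝ).restrict (Ioo a b)), g τ ≤ K) :
    ∀ τ ∈ Ioo a b, g τ ≤ K := by
  intro τ hτ
  by_contra hcon
  push Not at hcon
  have hca : ContinuousAt g τ := hg.continuousAt (Ioo_mem_nhds hτ.1 hτ.2)
  have hev : ∀ᶠ σ in 𝓝 τ, K < g σ := hca.eventually (lt_mem_nhds hcon)
  obtain ⟨δ, hδ, hball⟩ :=
    Metric.eventually_nhds_iff_ball.1 (hev.and (Ioo_mem_nhds hτ.1 hτ.2))
  have h' := (ae_restrict_iff' (measurableSet_Ioo (a := a) (b := b))).1 h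
  have hsub : ball τ δ ⊆ {σ | ¬(σ ∈ Ioo a b → g σ ≤ K)} := by
    intro σ hσ
    have := hball σ hσ
    simp only [mem_setOf_eq, Classical.not_imp, not_le]
    exact ⟨this.2, this.1⟩
  have hzero : volume {σ | ¬(σ ∈ Ioo a b → g σ ≤ K)} = 0 := ae_iff.1 h'
  have hb0 : volume (ball τ δ) = 0 := measure_mono_null hsub hzero
  rw [Real.volume_ball] at hb0
  have : (0 : ℝ≥0∞) < ENNReal.ofReal (2 * δ) := ENNReal.ofReal_pos.2 (by linarith)
  exact this.ne' hb0

/-- `‖D¹f(x)‖ = ‖Df(x)‖` for the first iterated derivative. [folklore] -/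
theorem norm_iteratedFDeriv_one_eq_norm_fderiv {F : Type*} [NormedAddCommGroup F] [NormedSpace ℝ F]
    (f : EuclideanSpace ℝ (Fin 3) → F) (x : EuclideanSpace ℝ (Fin 3)) :
    ‖iteratedFDeriv ℝ 1 f x‖ = ‖fderiv ℝ f x‖ := by
  rw [← norm_iteratedFDeriv_fderiv, norm_iteratedFDeriv_zero]

/-! ### Transfer of the KNSS window bounds to a continuous decaying representative -/

/-- **Transfer of the KNSS window bounds.** Let `w` be jointly smooth on `(0, T) × ℝ³` with the
spatial decay `‖y‖ ‖w(τ, y)‖ ≤ D`, and let `w(τ, ·) = U(τ, ·) + b(τ)` a.e. in `x` for a.e.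
`τ ∈ (0, T)`, where the slices `U(τ, ·)` are smooth with `‖DU‖ ≤ C₁` and
`‖U(τ, x) − U(σ, x)‖ ≤ L₀ |τ − σ|` on `(1, T)` (the output of
`KNSS2009_regularity_boundedWeak_window`). Then on `(1, T)`: `‖Dw(τ, ·)‖ ≤ C₁` at every time,
and `‖w(τ, x) − w(σ, x)‖ ≤ 2 L₀ |τ − σ|` for all pairs of times (the drift `b` is `L₀`-Lipschitz
on the good times because `U(τ, y) → −b(τ)` as `‖y‖ → ∞`; continuity in `τ` removes the
exceptional times). [folklore] -/
theorem window_transfer {T D C₁ L₀ : ℝ}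
    {w U : ℝ → EuclideanSpace ℝ (Fin 3) → EuclideanSpace ℝ (Fin 3)}
    {b : ℝ → EuclideanSpace ℝ (Fin 3)}
    (hw : IsSmoothSpaceTimeOn (Ioo 0 T) w) (hdec : ∀ τ ∈ Ioo 0 T, ∀ y, ‖y‖ * ‖w τ y‖ ≤ D)
    (hae : ∀ᵐ τ ∂((volume : Measure ℝ).restrict (Ioo 0 T)),
      w τ =ᵐ[volume] fun x => U τ x + b τ)
    (hUs : ∀ τ ∈ Ioo 0 T, ContDiff ℝ ∞ (U τ))
    (hUC : ∀ τ ∈ Ioo 1 T, ∀ x, ‖iteratedFDeriv ℝ 1 (U τ) x‖ ≤ C₁)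
    (hUL : ∀ σ ∈ Ioo 1 T, ∀ τ ∈ Ioo 1 T, ∀ x,
      ‖iteratedFDeriv ℝ 0 (U τ) x - iteratedFDeriv ℝ 0 (U σ) x‖ ≤ L₀ * |τ - σ|) :
    (∀ τ ∈ Ioo 1 T, ∀ x, ‖fderiv ℝ (w τ) x‖ ≤ C₁) ∧
      ∀ σ ∈ Ioo 1 T, ∀ τ ∈ Ioo 1 T, ∀ x, ‖w τ x - w σ x‖ ≤ 2 * L₀ * |τ - σ| := by
  have hSU : UniqueDiffOn ℝ (Ioo 0 T) := isOpen_Ioo.uniqueDiffOn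
  have hsub1 : Ioo 1 T ⊆ Ioo 0 T := Ioo_subset_Ioo_left zero_le_one
  -- continuity of `w` in each variable
  have hwc : ContinuousOn (uncurry w) (Ioo 0 T ×ˢ univ) := hw.continuousOn
  have hwτ : ∀ x, ContinuousOn (fun τ => w τ x) (Ioo 0 T) := fun x =>
    hwc.comp (continuousOn_id.prodMk continuousOn_const) fun τ hτ => mk_mem_prod hτ (mem_univ x)
  have hwx : ∀ τ ∈ Ioo 0 T, Continuous (w τ) := fun τ hτ =>
    (hw.contDiff_slice hτ).continuous
  -- good times: the a.e. identity holds everywhere in `x`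
  have hgood : ∀ᵐ τ ∂((volume : Measure ℝ).restrict (Ioo 0 T)),
      τ ∈ Ioo 0 T ∧ ∀ x, w τ x = U τ x + b τ := by
    filter_upwards [hae, ae_restrict_mem measurableSet_Ioo] with τ hτ hτm
    refine ⟨hτm, fun x => ?_⟩
    have hc2 : Continuous fun x => U τ x + b τ := (hUs τ hτm).continuous.add continuous_const
    exact congr_fun ((Continuous.ae_eq_iff_eq volume (hwx τ hτm) hc2).1 hτ) x
  have hgood1 : ∀ᵐ τ ∂((volume : Measure ℝ).restrict (Ioo 1 T)),
      τ ∈ Ioo 0 T ∧ ∀ x, w τ x = U τ x + b τ :=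
    ae_restrict_of_ae_restrict_of_subset hsub1 hgood
  -- Lipschitz bound of order zero for `U`
  have hUL' : ∀ σ ∈ Ioo 1 T, ∀ τ ∈ Ioo 1 T, ∀ x, ‖U τ x - U σ x‖ ≤ L₀ * |τ - σ| := by
    intro σ hσ τ hτ x
    rw [norm_sub_eq_norm_iteratedFDeriv_zero_sub]
    exact hUL σ hσ τ hτ x
  refine ⟨?_, ?_⟩
  · -- the spatial bound
    intro τ₀ hτ₀ x
    have hcont : ContinuousOn (fun τ => ‖fderiv ℝ (w τ) x‖) (Ioo 1 T) := by
      have h1 := (hw.continuousOn_fderiv_slice hSU).comp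
        (continuousOn_id.prodMk continuousOn_const) (fun τ hτ => mk_mem_prod hτ (mem_univ x))
      exact (h1.mono hsub1).norm
    refine le_of_ae_le_of_continuousOn hcont ?_ τ₀ hτ₀
    filter_upwards [hgood1, ae_restrict_mem measurableSet_Ioo] with τ hτ hτ1
    have heq : w τ = fun y => U τ y + b τ := funext hτ.2
    rw [heq, fderiv_add_const, ← norm_iteratedFDeriv_one_eq_norm_fderiv]
    exact hUC τ hτ1 x
  · -- the temporal bound, first between good times
    have hbb : ∀ σ τ : ℝ, σ ∈ Ioo 1 T → τ ∈ Ioo 1 T → (∀ y, w σ y = U σ y + b σ) →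
        (∀ y, w τ y = U τ y + b τ) → ‖b τ - b σ‖ ≤ L₀ * |τ - σ| := by
      intro σ τ hσ hτ hσg hτg
      refine le_of_forall_pos_lt_add fun ε hε => ?_
      -- a far-away point `y`
      have hD0 : 0 ≤ D := le_trans (by positivity) (hdec τ (hsub1 hτ) 0)
      set R : ℝ := 2 * D / ε + 1 with hR
      have hR0 : 0 < R := by positivity
      obtain ⟨y, hny⟩ : ∃ y : EuclideanSpace ℝ (Fin 3), ‖y‖ = R :=
        exists_norm_eq (EuclideanSpace ℝ (Fin 3)) hR0.le
      have hwy : ∀ ρ ∈ Ioo 0 T, ‖w ρ y‖ ≤ D / R := by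
        intro ρ hρ
        rw [le_div_iff₀ hR0, mul_comm, ← hny]
        exact hdec ρ hρ y
      have hsum : 2 * (D / R) < ε := by
        rw [← mul_div_assoc, div_lt_iff₀ hR0, hR]
        have e : ε * (2 * D / ε + 1) = 2 * D + ε := by field_simp
        linarith
      have hid : b τ - b σ = (w τ y - w σ y) - (U τ y - U σ y) := by
        rw [hσg y, hτg y]; abel
      calc ‖b τ - b σ‖ = ‖(w τ y - w σ y) - (U τ y - U σ y)‖ := by rw [hid]
        _ ≤ ‖w τ y - w σ y‖ + ‖U τ y - U σ y‖ := norm_sub_le _ _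
        _ ≤ (‖w τ y‖ + ‖w σ y‖) + L₀ * |τ - σ| :=
            add_le_add (norm_sub_le _ _) (hUL' σ hσ τ hτ y)
        _ ≤ (D / R + D / R) + L₀ * |τ - σ| := by
            gcongr
            · exact hwy τ (hsub1 hτ)
            · exact hwy σ (hsub1 hσ)
        _ < ε + L₀ * |τ - σ| := by linarith
        _ = L₀ * |τ - σ| + ε := add_comm _ _
    have hgg : ∀ σ τ : ℝ, σ ∈ Ioo 1 T → τ ∈ Ioo 1 T → (∀ y, w σ y = U σ y + b σ) →
        (∀ y, w τ y = U τ y + b τ) → ∀ x, ‖w τ x - w σ x‖ ≤ 2 * L₀ * |τ - σ| := by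
      intro σ τ hσ hτ hσg hτg x
      have hid : w τ x - w σ x = (U τ x - U σ x) + (b τ - b σ) := by
        rw [hσg x, hτg x]; abel
      calc ‖w τ x - w σ x‖ = ‖(U τ x - U σ x) + (b τ - b σ)‖ := by rw [hid]
        _ ≤ ‖U τ x - U σ x‖ + ‖b τ - b σ‖ := norm_add_le _ _
        _ ≤ L₀ * |τ - σ| + L₀ * |τ - σ| :=
            add_le_add (hUL' σ hσ τ hτ x) (hbb σ τ hσ hτ hσg hτg)
        _ = 2 * L₀ * |τ - σ| := by ring
    -- remove the exceptional `σ`, for good `τ`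
    have hstep : ∀ τ ∈ Ioo 1 T, (∀ y, w τ y = U τ y + b τ) →
        ∀ σ ∈ Ioo 1 T, ∀ x, ‖w τ x - w σ x‖ ≤ 2 * L₀ * |τ - σ| := by
      intro τ hτ hτg σ₀ hσ₀ x
      have hcont :
          ContinuousOn (fun σ => ‖w τ x - w σ x‖ - 2 * L₀ * |τ - σ|) (Ioo 1 T) := by
        refine ContinuousOn.sub (continuousOn_const.sub ((hwτ x).mono hsub1)).norm ?_
        exact (continuousOn_const.mul (continuousOn_const.sub continuousOn_id).abs)
      have key := le_of_ae_le_of_continuousOn (K := 0) hcont ?_ σ₀ hσ₀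
      · linarith
      filter_upwards [hgood1, ae_restrict_mem measurableSet_Ioo] with σ hσ hσ1
      linarith [hgg σ τ hσ1 hτ hσ.2 hτg x]
    -- remove the exceptional `τ`
    intro σ hσ τ₀ hτ₀ x
    have hcont :
        ContinuousOn (fun τ => ‖w τ x - w σ x‖ - 2 * L₀ * |τ - σ|) (Ioo 1 T) := by
      refine ContinuousOn.sub (((hwτ x).mono hsub1).sub continuousOn_const).norm ?_
      exact (continuousOn_const.mul (continuousOn_id.sub continuousOn_const).abs)
    have key := le_of_ae_le_of_continuousOn (K := 0) hcont ?_ τ₀ hτ₀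
    · linarith
    filter_upwards [hgood1, ae_restrict_mem measurableSet_Ioo] with τ hτ hτ1
    linarith [hstep τ hτ1 hτ.2 σ hσ x]

/-! ### Uniform Lipschitz bounds for Type I classical solutions -/

/-- Type I bound ⟹ `‖u(t, x)‖ ≤ C₀ / √(−t)`. [folklore] -/
theorem typeI_norm_le_div_sqrt {C₀ : ℝ} (hC₀ : 0 ≤ C₀)
    {u : ℝ → EuclideanSpace ℝ (Fin 3) → EuclideanSpace ℝ (Fin 3)}
    (hI : HasTypeIDecay C₀ u) {t : ℝ} (ht : t < 0) (x : EuclideanSpace ℝ (Fin 3)) :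
    ‖u t x‖ ≤ C₀ / √(-t) := by
  refine (hI t ht x).trans ?_
  exact div_le_div_of_nonneg_left hC₀ (Real.sqrt_pos.2 (by linarith))
    (le_add_of_nonneg_left (norm_nonneg _))

/-- Type I bound ⟹ `‖x‖ ‖u(t, x)‖ ≤ C₀`. [folklore] -/
theorem typeI_norm_mul_norm_le {C₀ : ℝ} (hC₀ : 0 ≤ C₀)
    {u : ℝ → EuclideanSpace ℝ (Fin 3) → EuclideanSpace ℝ (Fin 3)}
    (hI : HasTypeIDecay C₀ u) {t : ℝ} (ht : t < 0) (x : EuclideanSpace ℝ (Fin 3)) :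
    ‖x‖ * ‖u t x‖ ≤ C₀ := by
  have hs : 0 < √(-t) := Real.sqrt_pos.2 (by linarith)
  have hden : 0 < ‖x‖ + √(-t) := by positivity
  calc ‖x‖ * ‖u t x‖ ≤ ‖x‖ * (C₀ / (‖x‖ + √(-t))) := by gcongr; exact hI t ht x
    _ = C₀ * (‖x‖ / (‖x‖ + √(-t))) := by ring
    _ ≤ C₀ * 1 := by
        gcongr
        rw [div_le_one hden]
        linarith [hs.le]
    _ = C₀ := mul_one _

/-- Type I bound ⟹ `‖u(t, x)‖ ≤ 3 C₀` for `t < −1/8`. [folklore] -/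
theorem typeI_norm_le_three_mul {C₀ : ℝ} (hC₀ : 0 ≤ C₀)
    {u : ℝ → EuclideanSpace ℝ (Fin 3) → EuclideanSpace ℝ (Fin 3)}
    (hI : HasTypeIDecay C₀ u) {t : ℝ} (ht : t < -(1 / 8 : ℝ)) (x : EuclideanSpace ℝ (Fin 3)) :
    ‖u t x‖ ≤ 3 * C₀ := by
  refine (typeI_norm_le_div_sqrt hC₀ hI (by linarith) x).trans ?_
  have h13 : (1 / 3 : ℝ) ≤ √(-t) := (Real.le_sqrt' (by norm_num)).2 (by nlinarith)
  calc C₀ / √(-t) ≤ C₀ / (1 / 3) := div_le_div_of_nonneg_left hC₀ (by norm_num) h13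
    _ = 3 * C₀ := by ring

/-- Type I bound ⟹ `‖u(t, x)‖ ≤ 2 C₀` for `t ≤ −1/4`. [folklore] -/
theorem typeI_norm_le_two_mul {C₀ : ℝ} (hC₀ : 0 ≤ C₀)
    {u : ℝ → EuclideanSpace ℝ (Fin 3) → EuclideanSpace ℝ (Fin 3)}
    (hI : HasTypeIDecay C₀ u) {t : ℝ} (ht : t ≤ -(1 / 4 : ℝ)) (x : EuclideanSpace ℝ (Fin 3)) :
    ‖u t x‖ ≤ 2 * C₀ := by
  refine (typeI_norm_le_div_sqrt hC₀ hI (by linarith) x).trans ?_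
  have h12 : (1 / 2 : ℝ) ≤ √(-t) := (Real.le_sqrt' (by norm_num)).2 (by nlinarith)
  calc C₀ / √(-t) ≤ C₀ / (1 / 2) := div_le_div_of_nonneg_left hC₀ (by norm_num) h12
    _ = 2 * C₀ := by ring

/-- **Chae–Wolf 2017, proof of Thm. 1.3, the a priori estimates (3.6)–(3.7) in the form used for the
extraction: uniform Lipschitz bounds.** For every `C₀ ≥ 0` there are constants `K, L` such that
every classical solution `(u, p)` of Navier–Stokes (`ν = 1`, `f = 0`) on `ℝ³ × (−∞, 0)` with the
Type I bound `HasTypeIDecay C₀ u` is `K`-Lipschitz in space and `L`-Lipschitz in time on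
`(−∞, −1/4] × ℝ³`. (Printed: "by using the regularity theory of the Navier–Stokes equations we
infer `|∇ˡu| ≤ C_l /((−t)^{(1+l)/2} + |x|^{1+l})`"; here the regularity theory is KNSS 2009 §4
for bounded weak solutions on windows of length `17/8` ending before `−1/8`, where `|u| ≤ 3C₀`
(`KNSS2009_regularity_boundedWeak_window_holds`), transferred to `u` by `window_transfer`.) [cite: ChaeWolf2017RemovingDSS, §3 (3.6)–(3.7) (arXiv:1610.09464 p. 8)] -/
theorem exists_uniform_lipschitz {C₀ : ℝ} (hC₀ : 0 ≤ C₀) :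
    ∃ K L : ℝ, 0 ≤ K ∧ 0 ≤ L ∧ ∀ {u : ℝ → EuclideanSpace ℝ (Fin 3) → EuclideanSpace ℝ (Fin 3)}
      {p : ℝ → EuclideanSpace ℝ (Fin 3) → ℝ},
      IsClassicalNSSolutionOn (Iio 0) 1 0 u p → HasTypeIDecay C₀ u →
        (∀ t ≤ -(1 / 4 : ℝ), ∀ x y, ‖u t x - u t y‖ ≤ K * ‖x - y‖) ∧
        (∀ s ≤ -(1 / 4 : ℝ), ∀ t ≤ -(1 / 4 : ℝ), ∀ x, ‖u t x - u s x‖ ≤ L * |t - s|) := by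
  obtain ⟨Cw, Lw, N, hwin⟩ :=
    KNSS2009_regularity_boundedWeak_window_holds (3 * C₀) (17 / 8) (by norm_num)
  refine ⟨max (Cw 1 1) 0, max (2 * Lw 0 1) (4 * C₀), le_max_right _ _,
    le_max_of_le_right (by positivity), ?_⟩
  intro u p hcl hI
  -- the window based at a time `t ≤ -1/4`
  have hwindow : ∀ t ≤ -(1 / 4 : ℝ),
      (∀ x, ‖fderiv ℝ (u t) x‖ ≤ Cw 1 1) ∧
      ∀ s, t - 1 < s → s ≤ t → ∀ x, ‖u t x - u s x‖ ≤ 2 * Lw 0 1 * |t - s| := by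
    intro t ht
    set a : ℝ := t - 2 with ha
    set w : ℝ → EuclideanSpace ℝ (Fin 3) → EuclideanSpace ℝ (Fin 3) := fun τ => u (τ + a) with hw
    have hIoo : Ioo a (a + 17 / 8) ⊆ Iio 0 := fun τ hτ => by
      simp only [mem_Iio]; linarith [hτ.2]
    have hneg : ∀ τ ∈ Ioo (0 : ℝ) (17 / 8), τ + a < -(1 / 8 : ℝ) := fun τ hτ => by
      linarith [hτ.2]
    have hcl' : IsClassicalNSSolutionOn (Ioo a (a + 17 / 8)) 1 0 u p :=
      hcl.mono hIoo (uniqueDiffOn_Ioo _ _)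
    have hbdd : IsBoundedOn (Ioo a (a + 17 / 8)) u :=
      ⟨3 * C₀, fun τ hτ x => typeI_norm_le_three_mul hC₀ hI (by linarith [hτ.2]) x⟩
    have hweak : IsBoundedWeakNSSolutionOn (Ioo 0 (17 / 8)) isOpen_Ioo 1 w :=
      (hcl'.isBoundedWeakNSSolutionOn hbdd).comp_add_right a (J := Ioo 0 (17 / 8)) isOpen_Ioo
        fun τ => by
          simp only [mem_Ioo]
          constructor <;> intro h <;> constructor <;> linarith [h.1, h.2]
    have hM : ∀ τ ∈ Ioo (0 : ℝ) (17 / 8), ∀ x, ‖w τ x‖ ≤ 3 * C₀ := fun τ hτ x =>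
      typeI_norm_le_three_mul hC₀ hI (hneg τ hτ) x
    obtain ⟨U, b, -, -, -, hae, hUs, -, hUC, hUL, -⟩ := hwin hweak hM
    have hws : IsSmoothSpaceTimeOn (Ioo 0 (17 / 8)) w := by
      have h1 := hcl.smooth_velocity.comp_add_right a
      refine h1.mono fun τ hτ => ?_
      simp only [mem_preimage, mem_Iio]
      linarith [hneg τ hτ]
    have hdec : ∀ τ ∈ Ioo (0 : ℝ) (17 / 8), ∀ y, ‖y‖ * ‖w τ y‖ ≤ C₀ := fun τ hτ y =>
      typeI_norm_mul_norm_le hC₀ hI (by linarith [hneg τ hτ]) y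
    obtain ⟨hsp, htm⟩ := window_transfer hws hdec hae hUs (hUC 1 one_pos 1) (hUL 1 one_pos 0)
    have h2 : (2 : ℝ) ∈ Ioo (1 : ℝ) (17 / 8) := ⟨by norm_num, by norm_num⟩
    have e2 : w 2 = u t := by simp only [hw, ha]; congr 1; ring
    refine ⟨fun x => ?_, fun s hs1 hs2 x => ?_⟩
    · have := hsp 2 h2 x
      rwa [e2] at this
    · have hs' : s - a ∈ Ioo (1 : ℝ) (17 / 8) :=
        ⟨by rw [ha]; linarith, by rw [ha]; linarith⟩
      have key := htm (s - a) hs' 2 h2 x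
      have es : w (s - a) = u s := by simp only [hw]; congr 1; ring
      have eabs : |(2 : ℝ) - (s - a)| = |t - s| := by rw [ha]; congr 1; ring
      rwa [e2, es, eabs] at key
  refine ⟨fun t ht x y => ?_, fun s hs t ht x => ?_⟩
  · -- spatial Lipschitz bound by the mean value inequality
    have hdiff : ∀ z ∈ (univ : Set (EuclideanSpace ℝ (Fin 3))), DifferentiableAt ℝ (u t) z :=
      fun z _ =>
      ((hcl.contDiff_velocity (show t ∈ Iio 0 by simp only [mem_Iio]; linarith)).differentiable
        (by simp)).differentiableAt
    have hbound : ∀ z ∈ (univ : Set (EuclideanSpace ℝ (Fin 3))),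
        ‖fderiv ℝ (u t) z‖ ≤ max (Cw 1 1) 0 := fun z _ =>
      ((hwindow t ht).1 z).trans (le_max_left _ _)
    exact Convex.norm_image_sub_le_of_norm_fderiv_le hdiff hbound convex_univ (mem_univ y)
      (mem_univ x)
  · -- temporal Lipschitz bound
    rcases le_or_gt 1 |t - s| with hfar | hnear
    · -- far apart: use boundedness
      calc ‖u t x - u s x‖ ≤ ‖u t x‖ + ‖u s x‖ := norm_sub_le _ _
        _ ≤ 2 * C₀ + 2 * C₀ :=
            add_le_add (typeI_norm_le_two_mul hC₀ hI ht x) (typeI_norm_le_two_mul hC₀ hI hs x)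
        _ = 4 * C₀ * 1 := by ring
        _ ≤ max (2 * Lw 0 1) (4 * C₀) * |t - s| := by
            gcongr
            · exact le_max_right _ _
    · have habs := abs_lt.1 hnear
      have hL : 2 * Lw 0 1 * |t - s| ≤ max (2 * Lw 0 1) (4 * C₀) * |t - s| :=
        mul_le_mul_of_nonneg_right (le_max_left _ _) (abs_nonneg _)
      rcases le_total s t with hst | hts
      · exact (((hwindow t ht).2 s (by linarith [habs.2]) hst x).trans hL)
      · have key := (hwindow s hs).2 t (by linarith [habs.1]) hts x
        rw [norm_sub_rev, abs_sub_comm] at key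
        exact key.trans hL


end ChaeWolf

end Literature.Analysis.FluidPDE

end
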